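import Mathlib
import Summits.ValiantsHypothesis.ValiantsHypothesis.Theorems.FifoMatchingNNDivisionHardTorusHomogeneous
import Summits.ValiantsHypothesis.ValiantsHypothesis.Theorems.FifoMatchingNNSaturatedCofactors
import Summits.ValiantsHypothesis.ValiantsHypothesis.Theses.FifoMatching
import HarnessLib

/-!
# Route FifoMatching — crux `NNDivisionHard` (stmt-ValiantsHypothesis-21181): the crux is its CHEAP, TORUS-HOMOGENEOUS,
# HYPER-DEGREE, **UNSATURATED** tier, by name

Sharpening of the landed localisation `NNDivisionHard.TorusHomogeneous.nnDivisionHard_iff_torusTier` (21181 ⟺ every cheap,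
torus-homogeneous, hyper-degree cofactor is beaten) by the new rung `SaturatedCofactor.saturated_not_certificate_qp`
(`Theorems/FifoMatchingNNSaturatedCofactors.lean`: a torus-homogeneous cofactor each of whose nest-free perfect matchings
carries one of its monomials is NEVER a quasi-polynomial certificate, whatever its degree):

* `vertexDeg_eq_sum` — the tree's `vertexDeg d v` (arc-endpoints of the monomial `d` at `v`) is the vertex weight
  `Σ_j (d(v,j) + d(j,v))` of the saturated-cofactor file (bridge between the two spellings of torus-homogeneity);
* ★ `nnDivisionHard_iff_unsaturatedTier` — **`NNDivisionHard` ⟺ for every `c`, eventually in `n`, every nonzero cofactor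
  `h` which (i) is torus-homogeneous (one vertex-degree vector), (ii) has total degree `> 2^⌊n^{1/8}⌋`, (iii) is cheap,
  `L₊(h) ≤ 2^((log₂ n + c)^c)`, and (iv) is UNSATURATED — some nest-free perfect matching `P` of `[2n]` carries NO monomial
  of `h` (every monomial of `h` uses an arc outside `P`) — satisfies `2^((log₂ n + c)^c) < L₊(NN_n · h) + L₊(h)`.**

So the open residual of 21181 is now: cheap, astronomically-high-degree torus weight vectors that AVOID at least one
nest-free perfect matching.  HONEST FRAMING: by-name bookkeeping over landed engines (torus tier + saturated rung); no
progress is claimed on that residual; `NNDivisionHard`, `NNNotVP`, VP ≠ VNP remain OPEN (NOT proved).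
-/

noncomputable section

-- Sub = Summit single-conjunct layout: the duplicated namespace component is mandated by the tree.
set_option linter.dupNamespace false
set_option autoImplicit false

namespace Summit.ValiantsHypothesis.ValiantsHypothesis.Theorems.FifoMatching.NNDivisionHard.UnsaturatedTier

open Finset MvPolynomial Literature.Computability.AlgebraicComplexity
open Summit.ValiantsHypothesis.ValiantsHypothesis.Theorems.FifoMatching.NNLowDegreeCofactorHard (vertexDeg)
open Summit.ValiantsHypothesis.ValiantsHypothesis.Theorems.FifoMatching.NNDivisionHard.TorusHomogeneous
  (nnDivisionHard_iff_torusTier)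
open Summit.ValiantsHypothesis.ValiantsHypothesis.Theorems.FifoMatching.SaturatedCofactor
  (saturated_not_certificate_qp)
open scoped NNReal BigOperators

/-- Bridge: the tree's `vertexDeg d v` is the vertex weight `Σ_j (d(v,j) + d(j,v))`. [folklore] -/
theorem vertexDeg_eq_sum {m : ℕ} (d : (Fin m × Fin m) →₀ ℕ) (v : Fin m) :
    vertexDeg d v = ∑ j, (d (v, j) + d (j, v)) := by
  classical
  rw [Finset.sum_add_distrib]
  have h1 : (∑ e ∈ d.support with e.1 = v, d e) = ∑ j, d (v, j) := by
    calc (∑ e ∈ d.support with e.1 = v, d e)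
        = ∑ e ∈ (Finset.univ.filter fun e : Fin m × Fin m => e.1 = v), d e := by
          apply Finset.sum_subset
          · exact Finset.filter_subset_filter _ (Finset.subset_univ _)
          · intro e he hne
            rw [Finset.mem_filter] at he hne
            exact Finsupp.notMem_support_iff.mp fun h => hne ⟨h, he.2⟩
      _ = ∑ e ∈ (Finset.univ : Finset (Fin m)).image (fun j => (v, j)), d e := by
          congr 1
          ext e
          simp only [Finset.mem_filter, Finset.mem_univ, true_and, Finset.mem_image]
          constructor
          · intro he; exact ⟨e.2, by rw [← he]⟩
          · rintro ⟨j, rfl⟩; rfl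
      _ = ∑ j, d (v, j) := by
          rw [Finset.sum_image]
          intro j _ j' _ hjj'
          exact (Prod.ext_iff.mp hjj').2
  have h2 : (∑ e ∈ d.support with e.2 = v, d e) = ∑ j, d (j, v) := by
    calc (∑ e ∈ d.support with e.2 = v, d e)
        = ∑ e ∈ (Finset.univ.filter fun e : Fin m × Fin m => e.2 = v), d e := by
          apply Finset.sum_subset
          · exact Finset.filter_subset_filter _ (Finset.subset_univ _)
          · intro e he hne
            rw [Finset.mem_filter] at he hne
            exact Finsupp.notMem_support_iff.mp fun h => hne ⟨h, he.2⟩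
      _ = ∑ e ∈ (Finset.univ : Finset (Fin m)).image (fun j => (j, v)), d e := by
          congr 1
          ext e
          simp only [Finset.mem_filter, Finset.mem_univ, true_and, Finset.mem_image]
          constructor
          · intro he; exact ⟨e.1, by rw [← he]⟩
          · rintro ⟨j, rfl⟩; rfl
      _ = ∑ j, d (j, v) := by
          rw [Finset.sum_image]
          intro j _ j' _ hjj'
          exact (Prod.ext_iff.mp hjj').1
  unfold vertexDeg
  rw [h1, h2]

/-- ★ **`NNDivisionHard` ⟺ its cheap, torus-homogeneous, hyper-degree, UNSATURATED tier.**  What is OPEN in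
stmt-ValiantsHypothesis-21181 is exactly: for every `c`, eventually in `n`, every nonzero cofactor `h` over `ℝ≥0` that has ONE
vertex-degree vector, total degree `> 2^⌊n^{1/8}⌋`, cost `L₊(h) ≤ 2^((log₂ n + c)^c)`, and MISSES some nest-free perfect
matching `P` (no monomial of `h` is supported on the arcs of `P`), satisfies `2^((log₂ n + c)^c) < L₊(NN_n · h) + L₊(h)`;
saturated cofactors are dealt with by `SaturatedCofactor.saturated_not_certificate_qp`, the rest of the normalisation by
`nnDivisionHard_iff_torusTier`. [cite: JerrumSnir1982, §4.3] -/
theorem nnDivisionHard_iff_unsaturatedTier :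
    Summit.ValiantsHypothesis.ValiantsHypothesis.Theses.FifoMatching.NNDivisionHard ↔
    ∀ c : ℕ, ∃ n₀ : ℕ, ∀ n ≥ n₀, ∀ h : MvPolynomial (Fin (2 * n) × Fin (2 * n)) ℝ≥0, h ≠ 0 →
      (∀ d ∈ h.support, ∀ d' ∈ h.support, vertexDeg d = vertexDeg d') →
      2 ^ Nat.sqrt (Nat.sqrt (Nat.sqrt n)) < h.totalDegree →
      complexity h ≤ 2 ^ ((Nat.log 2 n + c) ^ c) →
      (∃ P ∈ nestFreeMatchings (2 * n), ∀ e ∈ h.support, ∃ a, e a ≠ 0 ∧ arcExponent P a = 0) →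
        2 ^ ((Nat.log 2 n + c) ^ c) < complexity (nestFreeMatchingPoly n ℝ≥0 * h) + complexity h := by
  constructor
  · intro H c
    obtain ⟨n₀, hn₀⟩ := H c
    exact ⟨n₀, fun n hn h hh _ _ _ _ => hn₀ n hn h hh⟩
  · intro H
    rw [nnDivisionHard_iff_torusTier]
    intro c
    obtain ⟨n₀, hn₀⟩ := H c
    obtain ⟨n₁, hn₁⟩ := saturated_not_certificate_qp c
    refine ⟨max n₀ n₁, fun n hn h hh hhom hdeg hcost => ?_⟩
    have hn0 : n₀ ≤ n := le_trans (le_max_left _ _) hn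
    have hn1 : n₁ ≤ n := le_trans (le_max_right _ _) hn
    by_cases hsat : ∀ P ∈ nestFreeMatchings (2 * n), ∃ e ∈ h.support, ∀ a, e a ≠ 0 → arcExponent P a ≠ 0
    · -- saturated: the new rung (vertex weights = the common vertex-degree vector)
      obtain ⟨d₀, hd₀⟩ := support_nonempty.mpr hh
      refine hn₁ n hn1 h (vertexDeg d₀) (fun e he i => ?_) hsat
      rw [← vertexDeg_eq_sum, hhom e he d₀ hd₀]
    · -- unsaturated: the tier
      push Not at hsat
      obtain ⟨P, hP, hmiss⟩ := hsat
      exact hn₀ n hn0 h hh hhom hdeg hcost ⟨P, hP, fun e he => by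
        obtain ⟨a, ha, hPa⟩ := hmiss e he
        exact ⟨a, ha, by simpa using hPa⟩⟩

end Summit.ValiantsHypothesis.ValiantsHypothesis.Theorems.FifoMatching.NNDivisionHard.UnsaturatedTier

end
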